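import Mathlib
import Literature.Analysis.InnerProduct.KahanEigenvaluePairing
import Summits.Ventures.YMGap.FlowData.EigenRadiusCertificate

/-!
# Venture YMGap, track Y3 FLOW-DATA — index-wise eigenvalues of `S` on an INVARIANT subspace from a
# near-orthonormal basis and a certified Rayleigh–Ritz block (lineage B's space-group blocks)

HONEST FRAMING: venture file of the cell `pub-ymgap` (QuantumFields programme), track Y3, lineage B
("B-kstm"), companion of `FlowData/EigenRadiusCertificate.lean`.  Lineage B's rows `m`, `m_B1`, `m_E`, …,
`lambda0_p…` come from SPACE-GROUP blocks of the kept transfer matrix `S_T`: the program (`kscert.c`,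
symmetry blocks) takes symmetry-adapted vectors `Y = (y₁ … y_m)` spanning an `S_T`-invariant subspace `W`
(an isotypic component of the lattice symmetry group inside an electric-flux sector — invariant because `S_T`
commutes with the group), forms the block `H ≈ Yᴴ S_T Y` in floating point, diagonalises it (`X`, `L`), and
certifies four residuals.  This file proves the theorem such a certificate needs, for finite matrices over
`ℝ` or `ℂ`: no lattice object, no number, no row; the program's interval arithmetic is not modelled (the
residual bounds are hypotheses), and the rounding of the entries of `Y` (the program's "subspace" term
`4·nS·θ`) is left to the caller — here `Y` is the exact matrix whose range is invariant.

WHAT IS TYPED (`λ↓` = Mathlib's descending `Matrix.IsHermitian.eigenvalues₀`):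
* `exists_orthonormal_eigenvectors_of_invariantBlock` — `S` Hermitian `N × N`, `Y` an `N × m` matrix with
  `S Y = Y C` for some `C` (the range of `Y` is `S`-invariant) and `Σ‖(Yᴴ Y − 1)ᵢⱼ‖² ≤ ε_G²` (`ε_G < 1`),
  `A`, `X` any `m × m` matrices, `L` real with `|L j| ≤ Lmax`, and `Σ‖(Yᴴ S Y − A)ᵢⱼ‖² ≤ E0²`,
  `Σ‖(A X − X·diag L)ᵢⱼ‖² ≤ E1²`, `Σ‖(Xᴴ X − 1)ᵢⱼ‖² ≤ ε²` (`ε < 1`).  THEN there are real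
  `λ₀ ≥ λ₁ ≥ ⋯ ≥ λ_{m−1}` and an ORTHONORMAL family `w₀, …, w_{m−1}` in the range of `Y` with `S wᵢ = λᵢ wᵢ`
  and `|λᵢ − λ↓ᵢ(diag L)| ≤ (E1 + √(1+ε)·(E0 + ε_G·Lmax)) / ((1 − ε_G)·√(1 − ε))` for EVERY `i` — Kahan's
  theorem for the definite pair `(Yᴴ S Y, Yᴴ Y)` (tree:
  `Literature.Analysis.InnerProduct.exists_basis_pencil_eigenvectors_abs_sub_eigenvalues_le`, Stewart–Sun
  Thms VI.1.15 + IV.5.4) followed by the lift `x ↦ Y x`; the invariance turns pencil eigenvectors into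
  eigenvectors of `S`.  The `ε_G·Lmax` term is the typed form of the program's "Ostrowski" correction for the
  non-orthonormal basis; no Ostrowski theorem is needed;
* `span_eq_range_of_invariantBlock` — that family SPANS the range of `Y` (so `λ₀ ≥ ⋯ ≥ λ_{m−1}` is the whole
  spectrum of `S` on `W = range Y`, counted with multiplicity);
* rectangular feeders `sum_norm_sq_mulVec_le'`, `norm_toEuclideanLin_le'`, `norm_sq_toEuclideanLin_bounds'`,
  `norm_toEuclideanLin_diagonal_le`.

References: G. W. Stewart, J.-G. Sun, *Matrix Perturbation Theory* (1990), Thm IV.5.4, Thm VI.1.15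
[cite: StewartSun1990, Thm VI.1.15]; W. Kahan, Proc. AMS 48 (1975) 11–17 [cite: Kahan1975]; the cell's
`pub-ymgap-flow-eng-2/kscert.c` (symmetry blocks, 2026-08-23).
-/

noncomputable section

open Matrix WithLp
open scoped InnerProductSpace

namespace Summit.Ventures.YMGap.FlowData

namespace EigenRadius

variable {𝕜 : Type*} [RCLike 𝕜] {N m : Type*} [Fintype N] [DecidableEq N] [Fintype m] [DecidableEq m]

/-! ### Rectangular feeders -/

omit [DecidableEq N] [DecidableEq m] in
/-- Row-wise Cauchy–Schwarz for a rectangular matrix: `Σᵢ ‖(R y)ᵢ‖² ≤ (Σᵢⱼ ‖Rᵢⱼ‖²) · Σⱼ ‖yⱼ‖²`. [folklore] -/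
theorem sum_norm_sq_mulVec_le' (R : Matrix N m 𝕜) (y : m → 𝕜) :
    ∑ i, ‖(R *ᵥ y) i‖ ^ 2 ≤ (∑ i, ∑ j, ‖R i j‖ ^ 2) * ∑ j, ‖y j‖ ^ 2 := by
  rw [Finset.sum_mul]
  refine Finset.sum_le_sum fun i _ => ?_
  have h1 : ‖(R *ᵥ y) i‖ ≤ ∑ j, ‖R i j‖ * ‖y j‖ := by
    change ‖∑ j, R i j * y j‖ ≤ _
    exact (norm_sum_le _ _).trans (le_of_eq (Finset.sum_congr rfl fun j _ => norm_mul _ _))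
  calc ‖(R *ᵥ y) i‖ ^ 2 ≤ (∑ j, ‖R i j‖ * ‖y j‖) ^ 2 := pow_le_pow_left₀ (norm_nonneg _) h1 2
    _ ≤ (∑ j, ‖R i j‖ ^ 2) * ∑ j, ‖y j‖ ^ 2 := Finset.sum_mul_sq_le_sq_mul_sq _ _ _

omit [DecidableEq N] in
/-- `‖R z‖ ≤ F ‖z‖` for a rectangular `R` with `Σᵢⱼ ‖Rᵢⱼ‖² ≤ F²`, `F ≥ 0`. [folklore] -/
theorem norm_toEuclideanLin_le' (R : Matrix N m 𝕜) {F : ℝ} (hF : 0 ≤ F)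
    (hR : ∑ i, ∑ j, ‖R i j‖ ^ 2 ≤ F ^ 2) (z : EuclideanSpace 𝕜 m) :
    ‖toEuclideanLin R z‖ ≤ F * ‖z‖ := by
  refine (pow_le_pow_iff_left₀ (norm_nonneg _) (mul_nonneg hF (norm_nonneg _)) two_ne_zero).1 ?_
  have h1 : toEuclideanLin R z = toLp 2 (R *ᵥ ofLp z) := rfl
  rw [h1, EuclideanSpace.norm_sq_eq, mul_pow, EuclideanSpace.norm_sq_eq]
  exact (sum_norm_sq_mulVec_le' R (ofLp z)).trans
    (mul_le_mul_of_nonneg_right hR (Finset.sum_nonneg fun _ _ => sq_nonneg _))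

/-- `Yᴴ Y` as an operator: `⟪(Yᴴ Y) x, v⟫ = ⟪Y x, Y v⟫`. [folklore] -/
theorem inner_gram_apply (Y : Matrix N m 𝕜) (x v : EuclideanSpace 𝕜 m) :
    ⟪toEuclideanLin (Yᴴ * Y) x, v⟫_𝕜 = ⟪toEuclideanLin Y x, toEuclideanLin Y v⟫_𝕜 := by
  have e : toEuclideanLin (Yᴴ * Y) x = toEuclideanLin Yᴴ (toEuclideanLin Y x) := by
    change toLp 2 ((Yᴴ * Y) *ᵥ ofLp x) = toLp 2 (Yᴴ *ᵥ ofLp (toLp 2 (Y *ᵥ ofLp x)))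
    rw [ofLp_toLp, mulVec_mulVec]
  rw [e, Matrix.toEuclideanLin_conjTranspose_eq_adjoint, LinearMap.adjoint_inner_left]

/-- Near-orthonormal columns, rectangular: `Σᵢⱼ ‖(Yᴴ Y − 1)ᵢⱼ‖² ≤ ε²` gives
`(1 − ε)‖z‖² ≤ ‖Y z‖² ≤ (1 + ε)‖z‖²`. [folklore] -/
theorem norm_sq_toEuclideanLin_bounds' (Y : Matrix N m 𝕜) {ε : ℝ} (hε : 0 ≤ ε)
    (hG : ∑ i, ∑ j, ‖(Yᴴ * Y - 1 : Matrix m m 𝕜) i j‖ ^ 2 ≤ ε ^ 2) (z : EuclideanSpace 𝕜 m) :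
    (1 - ε) * ‖z‖ ^ 2 ≤ ‖toEuclideanLin Y z‖ ^ 2 ∧
      ‖toEuclideanLin Y z‖ ^ 2 ≤ (1 + ε) * ‖z‖ ^ 2 := by
  set D : Matrix m m 𝕜 := (Yᴴ * Y - 1 : Matrix m m 𝕜) with hD
  have h1 : toEuclideanLin D z = toEuclideanLin (Yᴴ * Y) z - z := by
    change toLp 2 (D *ᵥ ofLp z) = toLp 2 ((Yᴴ * Y) *ᵥ ofLp z) - z
    rw [hD, sub_mulVec, one_mulVec, toLp_sub, toLp_ofLp]
  have hkey : ‖toEuclideanLin Y z‖ ^ 2 = ‖z‖ ^ 2 + RCLike.re ⟪toEuclideanLin D z, z⟫_𝕜 := by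
    rw [h1, inner_sub_left, map_sub, inner_gram_apply, ← norm_sq_eq_re_inner, ← norm_sq_eq_re_inner]
    ring
  have hDz : ‖toEuclideanLin D z‖ ≤ ε * ‖z‖ := norm_toEuclideanLin_le' D hε hG z
  have hre : |RCLike.re ⟪toEuclideanLin D z, z⟫_𝕜| ≤ ε * ‖z‖ ^ 2 := by
    calc |RCLike.re ⟪toEuclideanLin D z, z⟫_𝕜| ≤ ‖⟪toEuclideanLin D z, z⟫_𝕜‖ := RCLike.abs_re_le_norm _
      _ ≤ ‖toEuclideanLin D z‖ * ‖z‖ := norm_inner_le_norm _ _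
      _ ≤ (ε * ‖z‖) * ‖z‖ := mul_le_mul_of_nonneg_right hDz (norm_nonneg _)
      _ = ε * ‖z‖ ^ 2 := by ring
  rw [hkey]
  constructor
  · have := neg_abs_le (RCLike.re ⟪toEuclideanLin D z, z⟫_𝕜)
    linarith
  · have := le_abs_self (RCLike.re ⟪toEuclideanLin D z, z⟫_𝕜)
    linarith

/-- `‖diag(L) z‖ ≤ Lmax ‖z‖` when `|L j| ≤ Lmax` for all `j` (`Lmax ≥ 0`). [folklore] -/
theorem norm_toEuclideanLin_diagonal_le (L : m → ℝ) {Lmax : ℝ} (hLmax : 0 ≤ Lmax)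
    (hL : ∀ j, |L j| ≤ Lmax) (z : EuclideanSpace 𝕜 m) :
    ‖toEuclideanLin (diagonal fun j => ((L j : ℝ) : 𝕜)) z‖ ≤ Lmax * ‖z‖ := by
  refine (pow_le_pow_iff_left₀ (norm_nonneg _) (mul_nonneg hLmax (norm_nonneg _)) two_ne_zero).1 ?_
  have h1 : toEuclideanLin (diagonal fun j => ((L j : ℝ) : 𝕜)) z =
      toLp 2 ((diagonal fun j => ((L j : ℝ) : 𝕜)) *ᵥ ofLp z) := rfl
  rw [h1, EuclideanSpace.norm_sq_eq, mul_pow, EuclideanSpace.norm_sq_eq, Finset.mul_sum]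
  refine Finset.sum_le_sum fun j _ => ?_
  rw [PiLp.toLp_apply, mulVec_diagonal, norm_mul, mul_pow, RCLike.norm_ofReal]
  exact mul_le_mul_of_nonneg_right (pow_le_pow_left₀ (abs_nonneg _) (hL j) 2) (sq_nonneg _)

/-! ### The invariant-block theorem -/

/-- **Index-wise eigenvalues of `S` on an invariant subspace from a near-orthonormal basis and a certified
Rayleigh–Ritz block.**  Let `S` be Hermitian, `Y` an `N × m` matrix whose range is `S`-invariant
(`S Y = Y C`), nearly orthonormal (`Σ‖(Yᴴ Y − 1)ᵢⱼ‖² ≤ ε_G²`, `ε_G < 1`); let `A`, `X` be ANY `m × m`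
matrices (the floating-point block and its computed eigenvectors) and `L` real (`|L j| ≤ Lmax`) with
`Σ‖(Yᴴ S Y − A)ᵢⱼ‖² ≤ E0²`, `Σ‖(A X − X·diag L)ᵢⱼ‖² ≤ E1²`, `Σ‖(Xᴴ X − 1)ᵢⱼ‖² ≤ ε²` (`ε < 1`).  Then there
are `λ₀ ≥ ⋯ ≥ λ_{m−1}` and an orthonormal family `wᵢ` in the range of `Y` with `S wᵢ = λᵢ wᵢ` and
`|λᵢ − λ↓ᵢ(diag L)| ≤ (E1 + √(1+ε)(E0 + ε_G Lmax)) / ((1 − ε_G) √(1 − ε))` for every `i`.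
[cite: StewartSun1990, Thm VI.1.15] -/
theorem exists_orthonormal_eigenvectors_of_invariantBlock {S : Matrix N N 𝕜} (hS : S.IsHermitian)
    (Y : Matrix N m 𝕜) {C : Matrix m m 𝕜} (hSY : S * Y = Y * C) (A X : Matrix m m 𝕜) (L : m → ℝ)
    {E0 E1 ε εG Lmax : ℝ} (hE0 : 0 ≤ E0) (hE1 : 0 ≤ E1) (hε0 : 0 ≤ ε) (hε1 : ε < 1)
    (hεG0 : 0 ≤ εG) (hεG1 : εG < 1) (hLmax : 0 ≤ Lmax) (hL : ∀ j, |L j| ≤ Lmax)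
    (hG : ∑ i, ∑ j, ‖(Yᴴ * Y - 1 : Matrix m m 𝕜) i j‖ ^ 2 ≤ εG ^ 2)
    (h0 : ∑ i, ∑ j, ‖(Yᴴ * S * Y - A) i j‖ ^ 2 ≤ E0 ^ 2)
    (h1 : ∑ i, ∑ j, ‖(A * X - X * diagonal (fun j => ((L j : ℝ) : 𝕜))) i j‖ ^ 2 ≤ E1 ^ 2)
    (hX : ∑ i, ∑ j, ‖(Xᴴ * X - 1) i j‖ ^ 2 ≤ ε ^ 2) :
    ∃ (lam : Fin (Fintype.card m) → ℝ) (w : Fin (Fintype.card m) → EuclideanSpace 𝕜 N),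
      Antitone lam ∧ Orthonormal 𝕜 w ∧
      (∀ i, ∃ c : EuclideanSpace 𝕜 m, w i = toEuclideanLin Y c) ∧
      (∀ i, toEuclideanLin S (w i) = (lam i : 𝕜) • w i) ∧
      ∀ i, |lam i - (isHermitian_diagonal_ofReal (𝕜 := 𝕜) L).eigenvalues₀ i| ≤
        (E1 + √(1 + ε) * (E0 + εG * Lmax)) / ((1 - εG) * √(1 - ε)) := by
  set M : Matrix m m 𝕜 := diagonal (fun j => ((L j : ℝ) : 𝕜)) with hMdef
  have hM : M.IsHermitian := isHermitian_diagonal_ofReal (𝕜 := 𝕜) L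
  -- the operators of the pencil `(Yᴴ S Y, Yᴴ Y)` on `EuclideanSpace 𝕜 m`
  have hAsym : (toEuclideanLin (Yᴴ * S * Y)).IsSymmetric :=
    isSymmetric_toEuclideanLin_iff.mpr (isHermitian_conjTranspose_mul_mul Y hS)
  have hBsym : (toEuclideanLin (Yᴴ * Y)).IsSymmetric :=
    isSymmetric_toEuclideanLin_iff.mpr (isHermitian_conjTranspose_mul_self Y)
  have hMsym : (toEuclideanLin M).IsSymmetric := isSymmetric_toEuclideanLin_iff.mpr hM
  have h1εG : 0 < 1 - εG := by linarith
  have h1ε : 0 < 1 - ε := by linarith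
  -- `B = Yᴴ Y` is positive definite with constant `1 − ε_G`
  have hBβ : ∀ x : EuclideanSpace 𝕜 m,
      (1 - εG) * ‖x‖ ^ 2 ≤ RCLike.re ⟪toEuclideanLin (Yᴴ * Y) x, x⟫_𝕜 := fun x => by
    rw [inner_gram_apply, ← norm_sq_eq_re_inner]
    exact (norm_sq_toEuclideanLin_bounds' Y hεG0 hG x).1
  -- `σ_min` of `X` in the `B`-norm
  have hXs : ∀ z : EuclideanSpace 𝕜 m, √((1 - εG) * (1 - ε)) ^ 2 * ‖z‖ ^ 2 ≤
      RCLike.re ⟪toEuclideanLin (Yᴴ * Y) (toEuclideanLin X z), toEuclideanLin X z⟫_𝕜 := fun z => by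
    rw [Real.sq_sqrt (mul_nonneg h1εG.le h1ε.le), inner_gram_apply, ← norm_sq_eq_re_inner]
    calc (1 - εG) * (1 - ε) * ‖z‖ ^ 2 = (1 - εG) * ((1 - ε) * ‖z‖ ^ 2) := by ring
      _ ≤ (1 - εG) * ‖toEuclideanLin X z‖ ^ 2 :=
          mul_le_mul_of_nonneg_left (norm_sq_toEuclideanLin_bounds' X hε0 hX z).1 h1εG.le
      _ ≤ ‖toEuclideanLin Y (toEuclideanLin X z)‖ ^ 2 :=
          (norm_sq_toEuclideanLin_bounds' Y hεG0 hG (toEuclideanLin X z)).1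
  -- the residual of the pencil
  have hXle : ∀ z : EuclideanSpace 𝕜 m, ‖toEuclideanLin X z‖ ≤ √(1 + ε) * ‖z‖ := fun z => by
    refine (pow_le_pow_iff_left₀ (norm_nonneg _) (by positivity) two_ne_zero).1 ?_
    rw [mul_pow, Real.sq_sqrt (by linarith)]
    exact (norm_sq_toEuclideanLin_bounds' X hε0 hX z).2
  have hG' : ∑ i, ∑ j, ‖(1 - Yᴴ * Y : Matrix m m 𝕜) i j‖ ^ 2 ≤ εG ^ 2 := by
    refine le_trans (le_of_eq (Finset.sum_congr rfl fun i _ => Finset.sum_congr rfl fun j _ => ?_)) hG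
    rw [← neg_sub, neg_apply, norm_neg]
  have hR : ∀ z : EuclideanSpace 𝕜 m,
      ‖toEuclideanLin (Yᴴ * S * Y) (toEuclideanLin X z) -
          toEuclideanLin (Yᴴ * Y) (toEuclideanLin X (toEuclideanLin M z))‖ ≤
        (E1 + √(1 + ε) * (E0 + εG * Lmax)) * ‖z‖ := fun z => by
    have hdec : toEuclideanLin (Yᴴ * S * Y) (toEuclideanLin X z) -
          toEuclideanLin (Yᴴ * Y) (toEuclideanLin X (toEuclideanLin M z)) =
        toEuclideanLin (Yᴴ * S * Y - A) (toEuclideanLin X z) + toEuclideanLin (A * X - X * M) z +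
          toEuclideanLin (1 - Yᴴ * Y) (toEuclideanLin X (toEuclideanLin M z)) := by
      change toLp 2 ((Yᴴ * S * Y) *ᵥ ofLp (toLp 2 (X *ᵥ ofLp z))) -
          toLp 2 ((Yᴴ * Y) *ᵥ ofLp (toLp 2 (X *ᵥ ofLp (toLp 2 (M *ᵥ ofLp z))))) =
        toLp 2 ((Yᴴ * S * Y - A) *ᵥ ofLp (toLp 2 (X *ᵥ ofLp z))) + toLp 2 ((A * X - X * M) *ᵥ ofLp z) +
          toLp 2 ((1 - Yᴴ * Y) *ᵥ ofLp (toLp 2 (X *ᵥ ofLp (toLp 2 (M *ᵥ ofLp z)))))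
      rw [← toLp_sub, ← toLp_add, ← toLp_add]
      congr 1
      simp only [sub_mulVec, one_mulVec, ← mulVec_mulVec]
      abel
    rw [hdec]
    calc ‖toEuclideanLin (Yᴴ * S * Y - A) (toEuclideanLin X z) + toEuclideanLin (A * X - X * M) z +
          toEuclideanLin (1 - Yᴴ * Y) (toEuclideanLin X (toEuclideanLin M z))‖
        ≤ ‖toEuclideanLin (Yᴴ * S * Y - A) (toEuclideanLin X z)‖ + ‖toEuclideanLin (A * X - X * M) z‖ +
          ‖toEuclideanLin (1 - Yᴴ * Y) (toEuclideanLin X (toEuclideanLin M z))‖ := norm_add₃_le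
      _ ≤ E0 * ‖toEuclideanLin X z‖ + E1 * ‖z‖ + εG * ‖toEuclideanLin X (toEuclideanLin M z)‖ :=
          add_le_add (add_le_add (norm_toEuclideanLin_le' _ hE0 h0 _) (norm_toEuclideanLin_le' _ hE1 h1 _))
            (norm_toEuclideanLin_le' _ hεG0 hG' _)
      _ ≤ E0 * (√(1 + ε) * ‖z‖) + E1 * ‖z‖ + εG * (√(1 + ε) * (Lmax * ‖z‖)) := by
          gcongr
          · exact hXle z
          · exact (hXle _).trans (mul_le_mul_of_nonneg_left
              (norm_toEuclideanLin_diagonal_le L hLmax hL z) (by positivity))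
      _ = (E1 + √(1 + ε) * (E0 + εG * Lmax)) * ‖z‖ := by ring
  -- Kahan's theorem for the definite pair
  obtain ⟨lam, x, hlam, hAx, hBx, hK⟩ :=
    Literature.Analysis.InnerProduct.exists_basis_pencil_eigenvectors_abs_sub_eigenvalues_le hAsym hBsym
      finrank_euclideanSpace h1εG hBβ hMsym finrank_euclideanSpace (toEuclideanLin X)
      (Real.sqrt_pos.2 (mul_pos h1εG h1ε)) hXs hR
  refine ⟨lam, fun i => toEuclideanLin Y (x i), hlam, ?_, fun i => ⟨x i, rfl⟩, fun i => ?_, fun i => ?_⟩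
  · -- orthonormality: `⟪Y xᵢ, Y xⱼ⟫ = ⟪(Yᴴ Y) xᵢ, xⱼ⟫ = δᵢⱼ`
    refine orthonormal_iff_ite.2 fun i j => ?_
    rw [← inner_gram_apply]
    exact hBx i j
  · -- eigen-equation: `Yᴴ (S Y xᵢ − λᵢ Y xᵢ) = 0`, `S Y = Y C`, `Yᴴ Y` injective
    have hSYx : toEuclideanLin S (toEuclideanLin Y (x i)) = toEuclideanLin Y (toEuclideanLin C (x i)) := by
      change toLp 2 (S *ᵥ ofLp (toLp 2 (Y *ᵥ ofLp (x i)))) = toLp 2 (Y *ᵥ ofLp (toLp 2 (C *ᵥ ofLp (x i))))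
      rw [ofLp_toLp, ofLp_toLp, mulVec_mulVec, mulVec_mulVec, hSY]
    -- `v = C xᵢ − λᵢ xᵢ` satisfies `(Yᴴ Y) v = 0`
    set v : EuclideanSpace 𝕜 m := toEuclideanLin C (x i) - (lam i : 𝕜) • x i with hv
    have hBv : toEuclideanLin (Yᴴ * Y) v = 0 := by
      have e1 : toEuclideanLin (Yᴴ * Y) v =
          toEuclideanLin (Yᴴ * S * Y) (x i) - (lam i : 𝕜) • toEuclideanLin (Yᴴ * Y) (x i) := by
        rw [hv, map_sub, map_smul]
        congr 1
        change toLp 2 ((Yᴴ * Y) *ᵥ ofLp (toLp 2 (C *ᵥ ofLp (x i)))) = toLp 2 ((Yᴴ * S * Y) *ᵥ ofLp (x i))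
        rw [ofLp_toLp, mulVec_mulVec, Matrix.mul_assoc, ← hSY, ← Matrix.mul_assoc]
      rw [e1, hAx i, sub_self]
    have hv0 : v = 0 := by
      have h := hBβ v
      rw [hBv, inner_zero_left, map_zero] at h
      have h2 : ‖v‖ ^ 2 ≤ 0 := by
        by_contra hneg
        have : 0 < (1 - εG) * ‖v‖ ^ 2 := mul_pos h1εG (lt_of_not_ge hneg)
        linarith
      exact norm_eq_zero.1 (by nlinarith [norm_nonneg v])
    have hCx : toEuclideanLin C (x i) = (lam i : 𝕜) • x i := sub_eq_zero.1 (by rw [← hv]; exact hv0)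
    rw [hSYx, hCx, map_smul]
  · -- the radius: `ε_K / (s √β)` with `s = √((1−ε_G)(1−ε))`, `β = 1 − ε_G`
    have hden : √((1 - εG) * (1 - ε)) * √(1 - εG) = (1 - εG) * √(1 - ε) := by
      rw [Real.sqrt_mul h1εG.le, mul_comm (√(1 - εG)) (√(1 - ε)), mul_assoc,
        Real.mul_self_sqrt h1εG.le, mul_comm]
    have h := hK i
    rw [hden] at h
    exact h

omit [DecidableEq N] in
/-- **The certified family exhausts the invariant subspace.** In `exists_orthonormal_eigenvectors_of_invariantBlock`
the orthonormal family `w₀, …, w_{m−1}` lies in the range of `Y`, which has dimension `≤ m`; hence it SPANS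
that range: `λ₀ ≥ ⋯ ≥ λ_{m−1}` is the complete list of eigenvalues of `S` on `W = range Y`, with multiplicity.
[folklore] -/
theorem span_eq_range_of_invariantBlock (Y : Matrix N m 𝕜) {w : Fin (Fintype.card m) → EuclideanSpace 𝕜 N}
    (hw : Orthonormal 𝕜 w) (hwY : ∀ i, ∃ c : EuclideanSpace 𝕜 m, w i = toEuclideanLin Y c) :
    Submodule.span 𝕜 (Set.range w) = LinearMap.range (toEuclideanLin Y) := by
  have hle : Submodule.span 𝕜 (Set.range w) ≤ LinearMap.range (toEuclideanLin Y) := by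
    rw [Submodule.span_le]
    rintro _ ⟨i, rfl⟩
    obtain ⟨c, hc⟩ := hwY i
    exact ⟨c, hc.symm⟩
  refine Submodule.eq_of_le_of_finrank_le hle ?_
  -- `finrank (range Y) ≤ m = finrank (span w)`
  have h1 : Module.finrank 𝕜 (LinearMap.range (toEuclideanLin Y)) ≤ Fintype.card m := by
    calc Module.finrank 𝕜 (LinearMap.range (toEuclideanLin Y))
        ≤ Module.finrank 𝕜 (EuclideanSpace 𝕜 m) := LinearMap.finrank_range_le _
      _ = Fintype.card m := finrank_euclideanSpace
  have h2 : Module.finrank 𝕜 (Submodule.span 𝕜 (Set.range w)) = Fintype.card m := by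
    rw [finrank_span_eq_card hw.linearIndependent, Fintype.card_fin]
  omega

end EigenRadius

end Summit.Ventures.YMGap.FlowData
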